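import Mathlib
import Literature.MathematicalPhysics.QuantumLattice.EuclideanAction

/-!
# Route `UniversalDetector`, crux `DetectorRigidity` (stmt-QuantumFields-26595) — stub 3 of the birth skeleton, proved

Ideator seat ym-idea-8 g2, LINE 4 of rung R2a. The hyperoctahedral SPREADING step of the universal-detector lever
(`bc/DetectorRigidity_birth.lean`, `Stmt_symmetrySpread`, verbatim): if `K : ℝ⁴ → ℝ` is invariant under time reflection
and under coordinate permutations and vanishes on the open positive-time half-space `{z₀ > 0}`, then `K` vanishes on
`ℝ⁴ ∖ {0}` (move a non-zero coordinate into slot `0` by a transposition, flip its sign by `ϑ` if needed).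
With `Stmt_semigroupKill` (XL, OS semigroup) and `Stmt_gaussDeconv` (L, Weierstrass deconvolution) this composes to the crux
by `DetectorRigidity_of`; no summit, leg or spine crux is proved here.
-/

set_option autoImplicit false

namespace Summit.QuantumFields.YangMills.Cruxes.DetectorRigidity

open Literature.MathematicalPhysics.QuantumLattice

/-- **Stub 3 (`Stmt_symmetrySpread`) of the `DetectorRigidity` skeleton, proved.** -/
theorem symmetrySpread :
    ∀ (K : EuclideanSpace ℝ (Fin 4) → ℝ),
      (∀ z : EuclideanSpace ℝ (Fin 4), K (timeReflection 4 z) = K z) →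
      (∀ (σ : Equiv.Perm (Fin 4)) (z : EuclideanSpace ℝ (Fin 4)), K (WithLp.toLp 2 fun i => z (σ i)) = K z) →
      (∀ z : EuclideanSpace ℝ (Fin 4), 0 < z 0 → K z = 0) →
      ∀ z : EuclideanSpace ℝ (Fin 4), z ≠ 0 → K z = 0 := by
  intro K hθ hσ hpos z hz
  have hex : ∃ i : Fin 4, z i ≠ 0 := by
    by_contra h
    push Not at h
    exact hz (by ext i; simpa using h i)
  obtain ⟨i, hi⟩ := hex
  set z' : EuclideanSpace ℝ (Fin 4) := WithLp.toLp 2 fun j => z (Equiv.swap 0 i j) with hz'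
  have hKz : K z' = K z := hσ (Equiv.swap 0 i) z
  have hz'0 : z' 0 = z i := by simp [hz']
  rcases lt_or_gt_of_ne hi with hneg | hpos'
  · have h1 : K (timeReflection 4 z') = K z' := hθ z'
    have h2 : 0 < (timeReflection 4 z') 0 := by
      rw [timeReflection_apply, if_pos rfl, hz'0]; linarith
    rw [← hKz, ← h1]
    exact hpos _ h2
  · rw [← hKz]
    exact hpos _ (by rw [hz'0]; exact hpos')

end Summit.QuantumFields.YangMills.Cruxes.DetectorRigidity
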